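import Summits.KontsevichZagierPeriods.Zeta5Search.LaiSweepShard

/-!
# `κ₃` sweep certificate — shard file 038 of 127 (shards 266–272 of 889)

HONEST FRAMING. Systematic search; no irrationality claim unless certified. This file only checks,
by `decide +kernel`, shards 266–272 of the order-cell sweep of the `κ₃` point `(74, 2180, 444; δ74)`
(engine `LaiSweepEngine`, soundness `LaiSweepJump/Free/Eval/Shard/Kappa3`; a shard is `⟨regime, n,
p, q, p', q', Lo, Up⟩`: `n` cells from `p/q` to `p'/q'` with integer rate sums in `[Lo, Up]`, `K =
128`, `D = 2^40`). It draws NO conclusion: only the capstone `LaiKappa3SweepCert`, which needs all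
127 shard files, does. Kernel cost of this file ≈ 560 cells × 0.3 s.
-/

namespace Summit.KontsevichZagierPeriods.Zeta5Search.Sweep

set_option maxHeartbeats 100000000 in
/-- Shard 266: 80 cells of regime B from `260/1201` to `49/225`.
[cite: Lai2024BallRivoal, §4 Lemma 4.3] -/
theorem shard266 :
    Shard.check 128 (2^40)
      ⟨true, 80, 260, 1201, 49, 225, 31110067166804, 32174576491860⟩ = true := by
  decide +kernel

set_option maxHeartbeats 100000000 in
/-- Shard 267: 80 cells of regime B from `49/225` to `76/347`.
[cite: Lai2024BallRivoal, §4 Lemma 4.3] -/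
theorem shard267 :
    Shard.check 128 (2^40)
      ⟨true, 80, 49, 225, 76, 347, 29750230297243, 30781220903767⟩ = true := by
  decide +kernel

set_option maxHeartbeats 100000000 in
/-- Shard 268: 80 cells of regime B from `76/347` to `50/227`.
[cite: Lai2024BallRivoal, §4 Lemma 4.3] -/
theorem shard268 :
    Shard.check 128 (2^40)
      ⟨true, 80, 76, 347, 50, 227, 29655373335459, 30696565471871⟩ = true := by
  decide +kernel

set_option maxHeartbeats 100000000 in
/-- Shard 269: 80 cells of regime B from `50/227` to `68/307`.
[cite: Lai2024BallRivoal, §4 Lemma 4.3] -/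
theorem shard269 :
    Shard.check 128 (2^40)
      ⟨true, 80, 50, 227, 68, 307, 29252969168766, 30293121777532⟩ = true := by
  decide +kernel

set_option maxHeartbeats 100000000 in
/-- Shard 270: 80 cells of regime B from `68/307` to `39/175`.
[cite: Lai2024BallRivoal, §4 Lemma 4.3] -/
theorem shard270 :
    Shard.check 128 (2^40)
      ⟨true, 80, 68, 307, 39, 175, 32050743226959, 33210890565299⟩ = true := by
  decide +kernel

set_option maxHeartbeats 100000000 in
/-- Shard 271: 80 cells of regime B from `39/175` to `67/299`.
[cite: Lai2024BallRivoal, §4 Lemma 4.3] -/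
theorem shard271 :
    Shard.check 128 (2^40)
      ⟨true, 80, 39, 175, 67, 299, 28708049428997, 29756360792877⟩ = true := by
  decide +kernel

set_option maxHeartbeats 100000000 in
/-- Shard 272: 80 cells of regime B from `67/299` to `73/324`.
[cite: Lai2024BallRivoal, §4 Lemma 4.3] -/
theorem shard272 :
    Shard.check 128 (2^40)
      ⟨true, 80, 67, 299, 73, 324, 28724577911848, 29787201113199⟩ = true := by
  decide +kernel

/-- The checked shards of this file, in order. [folklore] -/
def shards038 : List (CheckedShard 128 (2^40)) :=
  [⟨_, shard266⟩, ⟨_, shard267⟩, ⟨_, shard268⟩, ⟨_, shard269⟩, ⟨_, shard270⟩,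
    ⟨_, shard271⟩, ⟨_, shard272⟩]

end Summit.KontsevichZagierPeriods.Zeta5Search.Sweep
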